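import Summits.Schanuel.Schanuel.Theorems.SoloInformedAE1tauEventually
import Summits.Schanuel.Schanuel.Theorems.SoloInformedTheoremAE3

/-!
# Theorem AE₃-1τ: the eventual inequalities

Soloist file (informed mode, seat `solo-Schanuel-informed`, s182).  Asymptotic bookkeeping for
the seat's THEOREM AE₃-1τ (`paper/AE-note.md` §14, `η = 0` form; node [cite: Roy2010, Thm 1.1]):
with `K = ⌊n^σ⌋`, `t = ⌊n^τ/2⌋ + 1` (`0 < σ, τ`, `β ≥ 1`) the explicit hypotheses of
`soloA3T_gelfond_input` hold for all large `n` — `soloTE_condB'` (the count of bad points with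
the constant `80000`, `1 + β < σ + τ + ν`), `soloTE_condC'` (`log 4 ≤ W/2`), `soloTE_condD'`
(the budget of THEOREM C₃ — THIS is where `ν > β + 3(1 - σ - τ)` is used: `K³ n^ν ≫ n³ n^β / t³`
with `K ≍ n^σ`, `t ≍ n^τ`), `soloTE_condE'` (the dilation losses) and `soloTE_condH'` (the
comparison with Gel'fond's lower bound), where `W = (n^ν/2) K / (160000 n)`.  The last three are
deduced from the corresponding inequalities of `SoloInformedAE1tauEventually` /
`SoloInformedTheoremAE3` at a slightly smaller exponent `ν' < ν` via `400 n^{ν'} ≤ n^ν`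
eventually (`soloTE_W_compare`); the remaining hypotheses (`soloTT_tfloor`, `soloTT_Kt`,
`soloTT_condA'`, `soloTT_condF'`, `soloTT_condG'`, `soloT3_floor`) are reused as they stand.

What this is NOT.  Pure real-analysis bookkeeping; nothing here bears on
`Literature.Periods.SchanuelConjecture` (the seat's verdict, no path, is unchanged).  Tree
files and Mathlib only; no definitions; axioms the standard three.
-/

namespace Summit.Schanuel.Schanuel.Theorems

open Filter

/-- The comparison with the constants of the earlier files: for `ν' < ν`, eventually
`n^{ν'} K/(160000 n) ≤ (n^ν/2) K/(320000 n) = W/2` and `(n^{ν'}/2) K/(400 n)/2 ≤ W/2`. -/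
theorem soloTE_W_compare (σ : ℝ) {ν ν' : ℝ} (h : ν' < ν) :
    ∀ᶠ n : ℕ in atTop,
      (n : ℝ) ^ ν' * ⌊(n : ℝ) ^ σ⌋₊ / (160000 * n) ≤
          (n : ℝ) ^ ν / 2 * ⌊(n : ℝ) ^ σ⌋₊ / (320000 * n) ∧
        (n : ℝ) ^ ν' * ⌊(n : ℝ) ^ σ⌋₊ / (160000 * n) ≤
          (n : ℝ) ^ ν / 2 * ⌊(n : ℝ) ^ σ⌋₊ / (160000 * n) / 2 ∧
        (n : ℝ) ^ ν' / 2 * ⌊(n : ℝ) ^ σ⌋₊ / (400 * n) / 2 ≤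
          (n : ℝ) ^ ν / 2 * ⌊(n : ℝ) ^ σ⌋₊ / (160000 * n) / 2 := by
  filter_upwards [eventually_ge_atTop 1, eventually_const_mul_rpow_le_rpow h 400] with n hn hc
  have hn0 : (0 : ℝ) < n := by exact_mod_cast hn
  have hK0 : (0 : ℝ) ≤ ⌊(n : ℝ) ^ σ⌋₊ := Nat.cast_nonneg _
  have base : 400 * ((n : ℝ) ^ ν' * ⌊(n : ℝ) ^ σ⌋₊) ≤ (n : ℝ) ^ ν * ⌊(n : ℝ) ^ σ⌋₊ := by
    rw [← mul_assoc]
    exact mul_le_mul_of_nonneg_right hc hK0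
  have hpos : 0 ≤ (n : ℝ) ^ ν' * ⌊(n : ℝ) ^ σ⌋₊ := by positivity
  have base' : 4 * ((n : ℝ) ^ ν' * ⌊(n : ℝ) ^ σ⌋₊) ≤ (n : ℝ) ^ ν * ⌊(n : ℝ) ^ σ⌋₊ := by
    linarith
  refine ⟨?_, ?_, ?_⟩
  · rw [show (n : ℝ) ^ ν' * ⌊(n : ℝ) ^ σ⌋₊ / (160000 * n) =
        4 * ((n : ℝ) ^ ν' * ⌊(n : ℝ) ^ σ⌋₊) / (640000 * n) by field_simp; ring,
      show (n : ℝ) ^ ν / 2 * ⌊(n : ℝ) ^ σ⌋₊ / (320000 * n) =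
        (n : ℝ) ^ ν * ⌊(n : ℝ) ^ σ⌋₊ / (640000 * n) by field_simp; ring]
    exact div_le_div_of_nonneg_right base' (by positivity)
  · rw [show (n : ℝ) ^ ν' * ⌊(n : ℝ) ^ σ⌋₊ / (160000 * n) =
        4 * ((n : ℝ) ^ ν' * ⌊(n : ℝ) ^ σ⌋₊) / (640000 * n) by field_simp; ring,
      show (n : ℝ) ^ ν / 2 * ⌊(n : ℝ) ^ σ⌋₊ / (160000 * n) / 2 =
        (n : ℝ) ^ ν * ⌊(n : ℝ) ^ σ⌋₊ / (640000 * n) by field_simp; ring]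
    exact div_le_div_of_nonneg_right base' (by positivity)
  · rw [show (n : ℝ) ^ ν' / 2 * ⌊(n : ℝ) ^ σ⌋₊ / (400 * n) / 2 =
        400 * ((n : ℝ) ^ ν' * ⌊(n : ℝ) ^ σ⌋₊) / (640000 * n) by field_simp; ring,
      show (n : ℝ) ^ ν / 2 * ⌊(n : ℝ) ^ σ⌋₊ / (160000 * n) / 2 =
        (n : ℝ) ^ ν * ⌊(n : ℝ) ^ σ⌋₊ / (640000 * n) by field_simp; ring]
    exact div_le_div_of_nonneg_right base (by positivity)

/-- Hypothesis `hbud` of `soloA3T_gelfond_input` (the count of bad points, constant `80000`),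
eventually, when `1 + β < σ + τ + ν`. -/
theorem soloTE_condB' {β σ τ ν : ℝ} (hβ : 1 ≤ β) (hσ0 : 0 < σ) (hτ0 : 0 < τ)
    (h : 1 + β < σ + τ + ν) :
    ∀ᶠ n : ℕ in atTop, 80000 * (10 * (n : ℝ) ^ 2 + 2 * n * (n + (n : ℝ) ^ β)) ≤
      ⌊(n : ℝ) ^ σ⌋₊ * (((⌊(n : ℝ) ^ τ / 2⌋₊ + 1 : ℕ) : ℝ) * ((n : ℝ) ^ ν / 8)) := by
  filter_upwards [soloT1_floor hσ0, soloTT_tfloor hτ0,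
    eventually_const_mul_rpow_le_rpow h 35840000]
    with n ⟨hn1, _u8, _u9, hKge⟩ ⟨_u10, _u11, htge, _u12⟩ hc
  have hn0 : (0 : ℝ) < n := by linarith
  have h2 : (n : ℝ) ^ 2 ≤ (n : ℝ) ^ (1 + β) := by
    rw [show (n : ℝ) ^ 2 = (n : ℝ) ^ ((2 : ℕ) : ℝ) by rw [Real.rpow_natCast]]
    exact Real.rpow_le_rpow_of_exponent_le hn1 (by push_cast; linarith)
  have h3 : (n : ℝ) * (n : ℝ) ^ β = (n : ℝ) ^ (1 + β) := by
    rw [Real.rpow_add hn0, Real.rpow_one]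
  have hL : 80000 * (10 * (n : ℝ) ^ 2 + 2 * n * (n + (n : ℝ) ^ β)) ≤
      1120000 * (n : ℝ) ^ (1 + β) := by nlinarith [h2, h3]
  have hR : (n : ℝ) ^ (σ + τ + ν) / 32 ≤
      ⌊(n : ℝ) ^ σ⌋₊ * (((⌊(n : ℝ) ^ τ / 2⌋₊ + 1 : ℕ) : ℝ) * ((n : ℝ) ^ ν / 8)) := by
    rw [Real.rpow_add hn0, Real.rpow_add hn0]
    calc (n : ℝ) ^ σ * (n : ℝ) ^ τ * (n : ℝ) ^ ν / 32
        = ((n : ℝ) ^ σ / 2) * (((n : ℝ) ^ τ / 2) * ((n : ℝ) ^ ν / 8)) := by ring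
      _ ≤ _ := by gcongr
  linarith [hc]

/-- Hypothesis `h₄` of `soloA3T_gelfond_input`: eventually `log 4 ≤ W/2 = (n^ν/2) K/(320000 n)`
(`ν > 1`). -/
theorem soloTE_condC' {σ ν : ℝ} (hσ0 : 0 < σ) (hν : 1 < ν) :
    ∀ᶠ n : ℕ in atTop, Real.log 4 ≤ (n : ℝ) ^ ν / 2 * ⌊(n : ℝ) ^ σ⌋₊ / (320000 * n) := by
  have hν' : 1 < (1 + ν) / 2 := by linarith
  have hlt : (1 + ν) / 2 < ν := by linarith
  filter_upwards [soloT3_condC hσ0 hν', soloTE_W_compare σ hlt] with n h hc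
  exact h.trans hc.1

/-- Hypothesis `h₅` of `soloA3T_gelfond_input` (the budget of THEOREM C₃), eventually — the one
place where `ν > β + 3(1 - σ - τ)` is used. -/
theorem soloTE_condD' {β σ τ ν : ℝ} (hβ : 1 ≤ β) (hσ0 : 0 < σ) (hτ0 : 0 < τ)
    (hν : β + 3 * (1 - σ - τ) < ν) :
    ∀ᶠ n : ℕ in atTop,
      400000 * (3 * ((n : ℝ) / ((⌊(n : ℝ) ^ τ / 2⌋₊ + 1 : ℕ) : ℝ)) ^ 2 *
          (2 * (n : ℝ) ^ β / ((⌊(n : ℝ) ^ τ / 2⌋₊ + 1 : ℕ) : ℝ)) +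
        2 * ((n : ℝ) / ((⌊(n : ℝ) ^ τ / 2⌋₊ + 1 : ℕ) : ℝ)) ^ 3) ≤
      (⌊(n : ℝ) ^ σ⌋₊ : ℝ) ^ 2 * ((n : ℝ) ^ ν / 2 * ⌊(n : ℝ) ^ σ⌋₊ / (160000 * n)) := by
  have hlt : 2 + β - 3 * τ < 3 * σ + ν - 1 := by linarith
  filter_upwards [soloT1_floor hσ0, soloTT_tfloor hτ0,
    eventually_const_mul_rpow_le_rpow hlt (400000 * 64 * 2560000)]
    with n ⟨hn1, hK1, _u13, hKge⟩ ⟨_u14, _u15, htge, _u16⟩ hc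
  have hn0 : (0 : ℝ) < n := by linarith
  set t : ℝ := ((⌊(n : ℝ) ^ τ / 2⌋₊ + 1 : ℕ) : ℝ) with htdef
  set K : ℝ := (⌊(n : ℝ) ^ σ⌋₊ : ℝ) with hKdef
  have ht0 : 0 < t := by rw [htdef]; positivity
  have hK0 : 0 < K := by
    rw [hKdef]
    exact_mod_cast (show 0 < ⌊(n : ℝ) ^ σ⌋₊ by omega)
  obtain ⟨hx, hy, -, -⟩ := soloTT_over_tK (β := β) (σ := σ) hn1 ht0 htge hK0 hKge
  have hx0 : 0 ≤ (n : ℝ) / t := by positivity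
  -- the left side is at most `400000 · 64 · n^{2+β-3τ}`
  have e1 : ((n : ℝ) ^ (1 - τ)) ^ 2 * (n : ℝ) ^ (β - τ) = (n : ℝ) ^ (2 + β - 3 * τ) := by
    rw [soloTT_rpow_pow hn0.le, ← Real.rpow_add hn0]
    congr 1
    push_cast
    ring
  have e2 : ((n : ℝ) ^ (1 - τ)) ^ 3 ≤ (n : ℝ) ^ (2 + β - 3 * τ) := by
    rw [soloTT_rpow_pow hn0.le]
    exact Real.rpow_le_rpow_of_exponent_le hn1 (by push_cast; linarith)
  have hx2 : ((n : ℝ) / t) ^ 2 ≤ (2 * (n : ℝ) ^ (1 - τ)) ^ 2 := pow_le_pow_left₀ hx0 hx 2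
  have hx3 : ((n : ℝ) / t) ^ 3 ≤ (2 * (n : ℝ) ^ (1 - τ)) ^ 3 := pow_le_pow_left₀ hx0 hx 3
  have hL : 400000 * (3 * ((n : ℝ) / t) ^ 2 * (2 * (n : ℝ) ^ β / t) +
      2 * ((n : ℝ) / t) ^ 3) ≤ 400000 * 64 * (n : ℝ) ^ (2 + β - 3 * τ) := by
    have h1 : ((n : ℝ) / t) ^ 2 * (2 * (n : ℝ) ^ β / t) ≤
        (2 * (n : ℝ) ^ (1 - τ)) ^ 2 * (4 * (n : ℝ) ^ (β - τ)) :=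
      mul_le_mul hx2 hy (by positivity) (by positivity)
    have h1' : (2 * (n : ℝ) ^ (1 - τ)) ^ 2 * (4 * (n : ℝ) ^ (β - τ)) =
        16 * (n : ℝ) ^ (2 + β - 3 * τ) := by rw [← e1]; ring
    have h2' : (2 * (n : ℝ) ^ (1 - τ)) ^ 3 = 8 * ((n : ℝ) ^ (1 - τ)) ^ 3 := by ring
    nlinarith [h1, h1', h2', hx3, e2]
  -- the right side is at least `n^{3σ+ν-1} / 2560000`
  have hR : (n : ℝ) ^ (3 * σ + ν - 1) / 2560000 ≤
      K ^ 2 * ((n : ℝ) ^ ν / 2 * K / (160000 * n)) := by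
    have hK3 : ((n : ℝ) ^ σ / 2) ^ 3 ≤ K ^ 3 := pow_le_pow_left₀ (by positivity) hKge 3
    have e3 : (n : ℝ) ^ (3 * σ + ν - 1) = ((n : ℝ) ^ σ) ^ 3 * (n : ℝ) ^ ν / n := by
      rw [soloTT_rpow_pow hn0.le, Real.rpow_sub hn0, Real.rpow_add hn0, Real.rpow_one]
      congr 2
      push_cast
      ring_nf
    rw [e3]
    have hν0 : 0 ≤ (n : ℝ) ^ ν := by positivity
    calc ((n : ℝ) ^ σ) ^ 3 * (n : ℝ) ^ ν / n / 2560000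
        = ((n : ℝ) ^ σ / 2) ^ 3 * (n : ℝ) ^ ν / (320000 * n) := by
          field_simp
          ring
      _ ≤ K ^ 3 * (n : ℝ) ^ ν / (320000 * n) :=
          div_le_div_of_nonneg_right (mul_le_mul_of_nonneg_right hK3 hν0) (by positivity)
      _ = K ^ 2 * ((n : ℝ) ^ ν / 2 * K / (160000 * n)) := by ring
  linarith [hc]

/-- Hypothesis `h₆` of `soloA3T_gelfond_input` (the dilation losses), eventually, when
`1 - τ < ν + σ - 1` and `β - σ - τ < ν + σ - 1`. -/
theorem soloTE_condE' (ξ : ℂ) {β σ τ ν : ℝ} (hσ0 : 0 < σ) (hτ0 : 0 < τ)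
    (hm1 : 1 - τ < ν + σ - 1) (hm2 : β - σ - τ < ν + σ - 1) :
    ∀ᶠ n : ℕ in atTop,
      20 * ((n : ℝ) / ((⌊(n : ℝ) ^ τ / 2⌋₊ + 1 : ℕ) : ℝ)) / ⌊(n : ℝ) ^ σ⌋₊ *
          Real.log (⌊(n : ℝ) ^ σ⌋₊ * ‖ξ‖ + 1) +
        20 * (2 * (n : ℝ) ^ β / ((⌊(n : ℝ) ^ τ / 2⌋₊ + 1 : ℕ) : ℝ)) / ⌊(n : ℝ) ^ σ⌋₊ ≤
      (n : ℝ) ^ ν / 2 * ⌊(n : ℝ) ^ σ⌋₊ / (160000 * n) / 2 := by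
  set δ : ℝ := min (ν + σ - 1 - (1 - τ)) (ν + σ - 1 - (β - σ - τ)) / 2 with hδ
  have hδ0 : 0 < δ := by
    rw [hδ]; exact half_pos (lt_min (by linarith) (by linarith))
  have hδ1 : δ < ν + σ - 1 - (1 - τ) := by
    have := min_le_left (ν + σ - 1 - (1 - τ)) (ν + σ - 1 - (β - σ - τ))
    rw [hδ]; linarith
  have hδ2 : δ < ν + σ - 1 - (β - σ - τ) := by
    have := min_le_right (ν + σ - 1 - (1 - τ)) (ν + σ - 1 - (β - σ - τ))
    rw [hδ]; linarith
  have hlt : ν - δ < ν := by linarith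
  filter_upwards [soloTT_condE' ξ hσ0 hτ0 (β := β) (ν := ν - δ) (by linarith) (by linarith),
    soloTE_W_compare σ hlt] with n h hc
  exact h.trans hc.2.2

/-- The comparison with Gel'fond's lower bound: eventually
`40 a (n+1)^{e₁} (n+1)^{e₂} < W/2` when `e₁ + e₂ < ν + σ − 1`. -/
theorem soloTE_condH' {σ ν e₁ e₂ : ℝ} (hσ0 : 0 < σ) (he₁ : 0 ≤ e₁) (he₂ : 0 ≤ e₂)
    (hE : e₁ + e₂ < ν + σ - 1) {a : ℝ} (ha : 0 < a) :
    ∀ᶠ n : ℕ in atTop, 40 * a * ((n : ℝ) + 1) ^ e₁ * ((n : ℝ) + 1) ^ e₂ <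
      (n : ℝ) ^ ν / 2 * ⌊(n : ℝ) ^ σ⌋₊ / (160000 * n) / 2 := by
  set δ : ℝ := (ν + σ - 1 - (e₁ + e₂)) / 2 with hδ
  have hlt : ν - δ < ν := by rw [hδ]; linarith
  have hE' : e₁ + e₂ < ν - δ + σ - 1 := by rw [hδ]; linarith
  filter_upwards [soloT3_condH hσ0 he₁ he₂ hE' ha, soloTE_W_compare σ hlt] with n h hc
  exact h.trans_le hc.2.1

end Summit.Schanuel.Schanuel.Theorems
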